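import Summits.QuantumAdvantage.AdviceFreeQNC0.LevelSetTransfer
import Summits.QuantumAdvantage.AdviceFreeQNC0.CrossTeamEmbedding
import Summits.QuantumAdvantage.AdviceFreeQNC0.EliminationHardness
import Summits.QuantumAdvantage.AdviceFreeQNC0.JointResidueElimination
import Literature.Computability.MetaComplexity.LowDegreeComposition
import HarnessLib

/-!
# Cell qa-qnc0 (rung F-Q1, route RingFrame, crux α `RingToElim`): the CERTIFICATE PARADIGM —
# composition degree, CERTIFICATE TRANSFER, and the end-to-end bookkeeping (planner qa-qnc0-p2
# ROUND-9, ask P-9C)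

Planner qa-qnc0-p2 gen 9 (`HOME/qa-qnc0-p2/ROUND-9.md` §2, `line/Sketch9.lean`, ns `QaQnc0.Sketch9p2`;
statements VERBATIM below: `RowDeg`, `RowCert`, `RowCertSuff`, `PolyGrowth`, `CompDeg`, `CertTransfer`,
`ViolaFence`, `RowCertPoly`, `CertParadigm`).  The three provable-now items are PROVED:

* `compDeg : CompDeg` (S) — a row functional of `𝔽₂`-degree `≤ s` in the `2^M` row coordinates,
  composed with a column-degree-`D` map `u ↦ Γ u`, is a Boolean polynomial of degree `≤ s·D` in `u`
  (the tree's `Smolensky.comp_mem_lowDeg_of_coord_mul`, after indexing the row coordinates through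
  `Fintype.equivFin`).
* `certTransfer : CertTransfer` (M) — a polynomially growing sufficient row-certificate family gives
  p1's one-sided low-degree farness witness `FWSuff` (`LevelSetTransfer`) at EVERY square-root degree
  profile `⌊c'√L⌋`.  Proof (the planner's plan): given leakage `b`, scale `τ`, slack `τ''`, take the
  certificate error `η = min(1/4, bτ''/2)` and a certificate family `Φ₀,…,Φ_{k−1}` for
  `(τ/c, τ, η)` on the rows of length `M = L'`; summing the two error guarantees over the rows
  (`Σ_i #{far rows where Φ_i is silent} ≤ ηk·#FAR_τ`, `Σ_i #{(τ/c)-near rows where Φ_i fires} ≤ ηk·2^L`)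
  and averaging over `i` (one weighted sum, `Finset.exists_le_of_sum_le`) yields ONE member `Φ_i`
  silent on `≤ 2η·#FAR_τ` far rows and firing on `≤ 2η·2^L` near rows.  When `#FAR_τ > 2τ''·2^L`
  the witness is `p := Φ_i ∘ Γ` (captures `≥ (1 − 2η) ≥ 1/2` of the far rows; its near leakage
  `2η·2^L ≤ bτ''·2^L < b·#supp p`); otherwise `p := ⊥`.  The degree `(A·s(D) + A)·D` of `p`
  (`compDeg`, `PolyGrowth`) is polylogarithmic in `L` since `D ≤ (log₂ min(L,L'))^C`, hence
  `≤ ⌊c'√L⌋` eventually (`certDeg_le_eventually`).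
* `certParadigm : CertParadigm` (S) — `CertTransfer → RowCertPoly → RingHard 2`, by
  `productHard_of_fwSuff_sqrt_of_elimHard` + `elimHard` + the landed chain
  `crossTeamHard_of_productHard`, `ringHardU_of_crossTeamHard`, `ringHard_two_of_walkHard`.

So in the kernel: **α ⟸ `RowCertPoly`** (some polynomially growing degree profile carries the
sufficient row-certificate family).  `RowCertPoly` is OPEN and NOT claimed; `ViolaFence` (F9-V) is the
typed lower fence (to be derived from Viola 2009 Thm 2 once that fact is filed, ask L-9V).

WHAT THIS IS NOT: no certificate is constructed; nothing on α itself; an instrument (the paradigm's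
transfer step made unconditional), not progress on the crux; separation NOT moved.
-/

noncomputable section

namespace Summit.QuantumAdvantage.AdviceFreeQNC0

open Finset
open Literature.Computability.MetaComplexity Literature.Computability.MetaComplexity.Smolensky

/-! ### Sketch9p2 (qn-p2 gen 9) statements, verbatim -/

/-- 𝔽₂-degree `≤ s` of a functional `Φ` on ROWS `w : (Fin M → Bool) → Bool`, i.e. of `Φ` read as a Boolean
function on the cube of dimension `#(Fin M → Bool) = 2^M` (row coordinates indexed through
`Fintype.equivFin`); the tree's `HasDeg`.  (Sketch9p2, verbatim.) -/
def RowDeg (M : ℕ) (Φ : ((Fin M → Bool) → Bool) → Bool) (s : ℕ) : Prop :=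
  HasDeg (n := Fintype.card (Fin M → Bool))
    (fun W : Fin (Fintype.card (Fin M → Bool)) → Bool =>
      Φ (fun z : Fin M → Bool => W (Fintype.equivFin (Fin M → Bool) z))) s

/-- **Row certificate** `RowCert M D s δ ε η`: a nonempty finite family `Φ₀, …, Φ_{k−1}` of row
functionals of degree `≤ s` such that at EVERY row `w` that is `δ`-close to the fail family (`distFail D w ≤
δ·2^M`) at most `η·k` of them fire, and at EVERY row that is `ε`-far (`distFail D w ≥ ε·2^M`) at most `η·k`
of them do not fire — a probabilistic polynomial, in Razborov's sense, for gap-closeness to `𝓕_M(D)`.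
(Sketch9p2, verbatim.) -/
def RowCert (M D s : ℕ) (δ ε η : ℝ) : Prop :=
  ∃ k : ℕ, 0 < k ∧ ∃ Φ : Fin k → ((Fin M → Bool) → Bool) → Bool, (∀ i, RowDeg M (Φ i) s) ∧
    (∀ w : (Fin M → Bool) → Bool, (distFail D w : ℝ) ≤ δ * (2 : ℝ) ^ M →
      ((univ.filter fun i : Fin k => Φ i w = true).card : ℝ) ≤ η * k) ∧
    (∀ w : (Fin M → Bool) → Bool, ε * (2 : ℝ) ^ M ≤ (distFail D w : ℝ) →
      ((univ.filter fun i : Fin k => Φ i w = false).card : ℝ) ≤ η * k)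

/-- **The sufficient certificate family** at degree profile `s : ℕ → ℕ` (a function of the strategy degree
`D` alone): one sandwich ratio `c ≥ 1`; for every scale `τ > 0` and every error `η > 0` the certificates
exist for all large `M` and all `D`, at degree `A·s(D) + A` with `A = A(τ, η)` absorbing the constants.
(Sketch9p2, verbatim.) -/
def RowCertSuff (s : ℕ → ℕ) : Prop :=
  ∃ c : ℝ, 1 ≤ c ∧ ∀ τ : ℝ, 0 < τ → ∀ η : ℝ, 0 < η → ∃ A M₀ : ℕ, ∀ M : ℕ, M₀ ≤ M → ∀ D : ℕ,
    RowCert M D (A * s D + A) (τ / c) τ η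

/-- polynomial growth of a degree profile (then `s((log L)^C)·(log L)^C ≤ c'√L` eventually, every `C`).
(Sketch9p2, verbatim.) -/
def PolyGrowth (s : ℕ → ℕ) : Prop := ∃ B : ℕ, ∀ D : ℕ, s D ≤ (D + 2) ^ B

/-- **Composition-degree lemma** (support, S/M): a degree-`s` row functional composed with a
column-degree-`D` map `u ↦ Γ u` is a Boolean polynomial of degree `≤ s·D` in `u`.
(Sketch9p2, verbatim.) -/
def CompDeg : Prop :=
  ∀ (L M s D : ℕ) (Φ : ((Fin M → Bool) → Bool) → Bool) (Γ : (Fin L → Bool) → (Fin M → Bool) → Bool),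
    RowDeg M Φ s → (∀ v, HasDeg (fun u => Γ u v) D) → HasDeg (fun u => Φ (Γ u)) (s * D)

/-- **CERTIFICATE TRANSFER** (typed target, M-sized, conjecture-free): a polynomially growing row-certificate
family gives p1's one-sided low-degree farness witness `FWSuff` (`LevelSetTransfer`) at EVERY square-root
degree profile; with `productHard_of_fwSuff_sqrt_of_elimHard`, `elimHard` and the landed chain
`ProductHard ⟹ CrossTeam ⟹ RingHardU ⟹ RingHard 2` this is α.  Proof plan: given `(b, τ, τ'')`, take
`η ≤ min(1/4, b·τ''/8)` and a certificate `Φ` for `(τ/c, τ, η)`; by double counting over the family some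
`Φ_i` misses `≤ 2η·#far_τ` far rows and fires on `≤ 2η·2^L` near rows; put `p := Φ_i ∘ Γ` (degree `s·D`
by `CompDeg`, `≤ ⌊c'√L⌋` eventually by `PolyGrowth`) when `#far_τ > 2τ''·2^L`, else `p := ⊥`.
(Sketch9p2, verbatim.) -/
def CertTransfer : Prop :=
  ∀ s : ℕ → ℕ, PolyGrowth s → RowCertSuff s → ∀ c' : ℝ, 0 < c' → FWSuff (fun n => ⌊c' * Real.sqrt n⌋₊)

/-- **FENCE F9-V (Viola)** — typed consequence of Viola 2009 Thm 2 (to be cited as a Literature fact) and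
the dual distance `2^{D+1}` of the fail code: below degree `D − log₂ s − log₂(1/δ) − 8` there is NO row
certificate, for any `δ < 1/4`, `ε < 1/4`, `η < 1/4` and all large `M`.  (Reason: a fail word plus `Ber(δ/2)`
noise is `δ`-close, a uniform row is `ε`-far, both with probability `→ 1`; some member of a certificate family
would distinguish the two with advantage `≥ 2 − 4η − o(1)` in `(−1)^Φ`-expectation, against Viola's bound
`16·exp(−2^{D+2−s}δ/s)`.)  NOT proved here (needs the Literature fact, ask L-9V).  (Sketch9p2, verbatim.) -/
def ViolaFence : Prop :=
  ∀ δ ε η : ℝ, 0 < δ → δ < 1 / 4 → 0 < ε → ε < 1 / 4 → 0 < η → η < 1 / 4 → ∀ s D : ℕ,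
    s + Nat.clog 2 s + Nat.clog 2 ⌈1 / δ⌉₊ + 8 ≤ D → ∃ M₀ : ℕ, ∀ M : ℕ, M₀ ≤ M → ¬ RowCert M D s δ ε η

/-- **The open question the paradigm reduces α to** (NOT claimed; recorded as the typed dichotomy): some
polynomially growing profile carries the sufficient certificate family.  By `ViolaFence` any such profile has
`A·s(D) + A ≥ D − O(log(D/δ))`; a negative answer for every `2^{o(D)}` profile would close the certificate
paradigm beyond the log-degree regime (where degree-`2^{O(D)}` certificates by flat restriction plus an exact
ball test are the natural — unverified — candidates, re-deriving at most T6's range).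
(Sketch9p2, verbatim.) -/
def RowCertPoly : Prop := ∃ s : ℕ → ℕ, PolyGrowth s ∧ RowCertSuff s

/-- bookkeeping (target, S): the paradigm's end-to-end implication, from `CertTransfer` and the tree.
(Sketch9p2, verbatim.) -/
def CertParadigm : Prop := CertTransfer → RowCertPoly → RingHard 2

/-! ### `CompDeg` -/

/-- **`CompDeg` — PROVED**: index the `2^M` row coordinates by `Fintype.equivFin`; the coordinate
`(Γ u)(z)` of the composed map has the degree-`D` indicator `u ↦ Γ u z`, so the tree's composition lemma
(`Smolensky.comp_mem_lowDeg_of_coord_mul`: a monomial of `≤ s` coordinates becomes a product of `≤ s`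
indicators of degree `≤ D`) gives degree `≤ s·D`. -/
theorem compDeg : CompDeg := by
  classical
  intro L M s D Φ Γ hΦ hΓ
  -- the composed map in the `Fin (2^M)` row coordinates
  set e : (Fin L → Bool) → (Fin (Fintype.card (Fin M → Bool)) → Bool) :=
    fun u i => Γ u ((Fintype.equivFin (Fin M → Bool)).symm i) with he_def
  have he : ∀ i, (fun u => if e u i = true then (1 : ZMod 2) else 0) ∈ lowDeg (ZMod 2) L D :=
    fun i => hΓ ((Fintype.equivFin (Fin M → Bool)).symm i)
  have hΦ' : (fun W : Fin (Fintype.card (Fin M → Bool)) → Bool =>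
      if Φ (fun z : Fin M → Bool => W (Fintype.equivFin (Fin M → Bool) z)) then (1 : ZMod 2) else 0) ∈
        lowDeg (ZMod 2) (Fintype.card (Fin M → Bool)) s := hΦ
  have h := Smolensky.comp_mem_lowDeg_of_coord_mul (F := ZMod 2) e he hΦ'
  unfold HasDeg
  convert h using 3 with u
  simp only [he_def, Equiv.symm_apply_apply]

/-! ### The degree budget: polylog against the square root -/

/-- The degree of the transferred witness is eventually within the square-root budget: for
`D ≤ (log₂ min(L, L'))^C`, `(A·(D+2)^B + A)·D ≤ ⌊c'·√L⌋` once `L ≥ L₀(A, B, C, c')`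
(since `(A(D+2)^B + A)·D ≤ (A·3^B + A)·(log₂ L)^{CB + C}` and `(log₂ L)^E = o(√L)`,
`logPow_le_sqrt'`). [folklore] -/
theorem certDeg_le_eventually (A B C : ℕ) {c' : ℝ} (hc' : 0 < c') :
    ∃ L₀ : ℕ, ∀ L : ℕ, L₀ ≤ L → ∀ L' D : ℕ, D ≤ (Nat.log 2 (min L L')) ^ C →
      (A * (D + 2) ^ B + A) * D ≤ ⌊c' * Real.sqrt L⌋₊ := by
  set K : ℕ := A * 3 ^ B + A with hK_def
  obtain ⟨n₀, hn₀⟩ := logPow_le_sqrt' (C * B + C) (c₀ := c' / ((K : ℝ) + 1)) (by positivity)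
  refine ⟨max n₀ 2, fun L hL L' D hD => ?_⟩
  have hn₀L : n₀ ≤ L := le_trans (le_max_left _ _) hL
  have hL2 : 2 ≤ L := le_trans (le_max_right _ _) hL
  set ℓ := Nat.log 2 L with hℓ_def
  have hℓ1 : 1 ≤ ℓ := Nat.log_pos one_lt_two hL2
  have hDℓ : D ≤ ℓ ^ C :=
    le_trans hD (Nat.pow_le_pow_left (Nat.log_mono_right (min_le_left _ _)) C)
  have hpow1 : 1 ≤ ℓ ^ C := Nat.one_le_pow _ _ hℓ1
  have hpow2 : 1 ≤ ℓ ^ (C * B) := Nat.one_le_pow _ _ hℓ1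
  have h1 : D + 2 ≤ 3 * ℓ ^ C := by omega
  have h2 : (D + 2) ^ B ≤ 3 ^ B * ℓ ^ (C * B) := by
    calc (D + 2) ^ B ≤ (3 * ℓ ^ C) ^ B := Nat.pow_le_pow_left h1 B
      _ = 3 ^ B * ℓ ^ (C * B) := by rw [mul_pow, ← pow_mul]
  have h3 : (A * (D + 2) ^ B + A) * D ≤ K * ℓ ^ (C * B + C) := by
    calc (A * (D + 2) ^ B + A) * D ≤ (A * (3 ^ B * ℓ ^ (C * B)) + A * ℓ ^ (C * B)) * ℓ ^ C :=
          Nat.mul_le_mul (Nat.add_le_add (Nat.mul_le_mul_left A h2)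
            (Nat.le_mul_of_pos_right A (lt_of_lt_of_le Nat.zero_lt_one hpow2))) hDℓ
      _ = K * ℓ ^ (C * B + C) := by rw [hK_def, pow_add]; ring
  have hreal : (((K * ℓ ^ (C * B + C) : ℕ)) : ℝ) ≤ c' * Real.sqrt L := by
    have h := hn₀ L hn₀L
    have hK0 : (0 : ℝ) ≤ (K : ℝ) := Nat.cast_nonneg K
    have hK1 : (K : ℝ) / ((K : ℝ) + 1) ≤ 1 := by
      rw [div_le_one (by positivity)]; linarith
    have hcs : (0 : ℝ) ≤ c' * Real.sqrt L := by positivity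
    push_cast at h ⊢
    calc (K : ℝ) * (ℓ : ℝ) ^ (C * B + C) ≤ (K : ℝ) * (c' / ((K : ℝ) + 1) * Real.sqrt L) :=
          mul_le_mul_of_nonneg_left h hK0
      _ = (K : ℝ) / ((K : ℝ) + 1) * (c' * Real.sqrt L) := by ring
      _ ≤ 1 * (c' * Real.sqrt L) := mul_le_mul_of_nonneg_right hK1 hcs
      _ = c' * Real.sqrt L := one_mul _
  exact Nat.le_floor (le_trans (by exact_mod_cast h3) hreal)

/-! ### `CertTransfer` -/

/-- **CERTIFICATE TRANSFER — PROVED** (`Sketch9p2.CertTransfer`): `PolyGrowth s → RowCertSuff s →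
∀ c' > 0, FWSuff ⌊c'√·⌋`, with the certificate family's own sandwich ratio `c`, capture `a = 1/2`, and,
for leakage `b`, scale `τ`, slack `τ''`, the certificate error `η = min(1/4, bτ''/2)`; one weighted
Markov step over the family picks the member `Φ_i`; the witness is `Φ_i ∘ Γ` when
`#FAR_τ > 2τ''·2^L` and `⊥` otherwise (see the module docstring). -/
theorem certTransfer : CertTransfer := by
  classical
  intro s hPG hRC c' hc'
  obtain ⟨c, hc1, hcert⟩ := hRC
  obtain ⟨B, hB⟩ := hPG
  refine ⟨c, hc1, 1 / 2, by norm_num, fun b hb τ hτ τ'' hτ'' => ?_⟩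
  -- the certificate error
  set η : ℝ := min (1 / 4) (b * τ'' / 2) with hη_def
  have hηpos : 0 < η := lt_min (by norm_num) (by positivity)
  have hη4 : η ≤ 1 / 4 := min_le_left _ _
  have hηb : 2 * η ≤ b * τ'' := by
    have := min_le_right (1 / 4 : ℝ) (b * τ'' / 2); linarith
  obtain ⟨A, M₀, hAM⟩ := hcert τ hτ η hηpos
  intro C
  obtain ⟨L₁, hL₁⟩ := certDeg_le_eventually A B C hc'
  refine ⟨max M₀ L₁, fun L L' hL hL' D hD Γ hΓ r => ?_⟩
  have hM₀ : M₀ ≤ L' := le_trans (le_max_left _ _) hL'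
  have hL₁L : L₁ ≤ L := le_trans (le_max_right _ _) hL
  obtain ⟨k, hk, Φ, hΦdeg, hnear, hfar⟩ := hAM L' hM₀ D
  -- the far rows at scale `τ` and the near rows at scale `τ/c`
  set F := far D Γ τ with hF_def
  set Nr := near D Γ (τ / c) with hN_def
  have h2L : (0 : ℝ) < (2 : ℝ) ^ L := by positivity
  have hFnn : (0 : ℝ) ≤ (F.card : ℝ) := Nat.cast_nonneg _
  by_cases hsmall : (F.card : ℝ) ≤ 2 * τ'' * (2 : ℝ) ^ L
  · -- few far rows: the empty witness
    refine ⟨fun _ => false, hasDeg_false _, ?_, ?_⟩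
    · have h0 : ((univ.filter fun u : Fin L → Bool => false = true) ∩ F).card = 0 := by simp
      rw [h0]; push_cast; linarith
    · have h0 : ((univ.filter fun u : Fin L → Bool => false = true) ∩ Nr ∩ cls L r).card = 0 := by
        simp
      have h1 : (univ.filter fun u : Fin L → Bool => false = true).card = 0 := by simp
      rw [h0, h1]; simp
  · push Not at hsmall
    have hFpos : (0 : ℝ) < (F.card : ℝ) := lt_of_le_of_lt (by positivity) hsmall
    -- the two error counts of each member of the family
    set X : Fin k → ℝ := fun i => ((F.filter fun u => Φ i (Γ u) = false).card : ℝ) with hX_def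
    set Y : Fin k → ℝ := fun i => ((Nr.filter fun u => Φ i (Γ u) = true).card : ℝ) with hY_def
    -- summing the far-side guarantee over the far rows
    have hXsum : ∑ i, X i ≤ η * k * F.card := by
      have hswap : (∑ i : Fin k, (F.filter fun u => Φ i (Γ u) = false).card) =
          ∑ u ∈ F, (univ.filter fun i : Fin k => Φ i (Γ u) = false).card := by
        simp only [Finset.card_filter]
        exact Finset.sum_comm
      have hswapR : ∑ i, X i = ∑ u ∈ F, ((univ.filter fun i : Fin k => Φ i (Γ u) = false).card : ℝ) := by
        simp only [hX_def]
        exact_mod_cast hswap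
      rw [hswapR]
      calc ∑ u ∈ F, ((univ.filter fun i : Fin k => Φ i (Γ u) = false).card : ℝ)
          ≤ ∑ u ∈ F, η * k := by
            refine Finset.sum_le_sum fun u hu => hfar (Γ u) ?_
            have hu' := hu
            simp only [hF_def, far, Finset.mem_filter, Finset.mem_univ, true_and] at hu'
            exact hu'
        _ = η * k * F.card := by rw [Finset.sum_const, nsmul_eq_mul]; ring
    -- summing the near-side guarantee over the near rows
    have hYsum : ∑ i, Y i ≤ η * k * (2 : ℝ) ^ L := by
      have hswap : (∑ i : Fin k, (Nr.filter fun u => Φ i (Γ u) = true).card) =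
          ∑ u ∈ Nr, (univ.filter fun i : Fin k => Φ i (Γ u) = true).card := by
        simp only [Finset.card_filter]
        exact Finset.sum_comm
      have hswapR : ∑ i, Y i = ∑ u ∈ Nr, ((univ.filter fun i : Fin k => Φ i (Γ u) = true).card : ℝ) := by
        simp only [hY_def]
        exact_mod_cast hswap
      have hNcard : (Nr.card : ℝ) ≤ (2 : ℝ) ^ L := by
        have h : Nr.card ≤ 2 ^ L := by
          calc Nr.card ≤ Fintype.card (Fin L → Bool) := Finset.card_le_univ _
            _ = 2 ^ L := by rw [Fintype.card_fun, Fintype.card_bool, Fintype.card_fin]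
        exact_mod_cast h
      rw [hswapR]
      calc ∑ u ∈ Nr, ((univ.filter fun i : Fin k => Φ i (Γ u) = true).card : ℝ)
          ≤ ∑ u ∈ Nr, η * k := by
            refine Finset.sum_le_sum fun u hu => hnear (Γ u) ?_
            have hu' := hu
            simp only [hN_def, near, Finset.mem_filter, Finset.mem_univ, true_and] at hu'
            exact hu'.le
        _ = η * k * Nr.card := by rw [Finset.sum_const, nsmul_eq_mul]; ring
        _ ≤ η * k * (2 : ℝ) ^ L := mul_le_mul_of_nonneg_left hNcard (by positivity)
    -- one weighted Markov step over the family
    obtain ⟨i, -, hi⟩ : ∃ i ∈ (univ : Finset (Fin k)),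
        X i * (2 : ℝ) ^ L + Y i * F.card ≤ 2 * η * F.card * (2 : ℝ) ^ L := by
      apply Finset.exists_le_of_sum_le ⟨⟨0, hk⟩, Finset.mem_univ _⟩
      rw [Finset.sum_add_distrib, ← Finset.sum_mul, ← Finset.sum_mul, Finset.sum_const,
        Finset.card_univ, Fintype.card_fin, nsmul_eq_mul]
      calc (∑ i, X i) * (2 : ℝ) ^ L + (∑ i, Y i) * F.card
          ≤ η * k * F.card * (2 : ℝ) ^ L + η * k * (2 : ℝ) ^ L * F.card :=
            add_le_add (mul_le_mul_of_nonneg_right hXsum h2L.le)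
              (mul_le_mul_of_nonneg_right hYsum hFnn)
        _ = (k : ℝ) * (2 * η * F.card * (2 : ℝ) ^ L) := by ring
    have hX0 : 0 ≤ X i := Nat.cast_nonneg _
    have hY0 : 0 ≤ Y i := Nat.cast_nonneg _
    have hXi : X i ≤ 2 * η * F.card :=
      le_of_mul_le_mul_right (by nlinarith [mul_nonneg hY0 hFnn]) h2L
    have hYi : Y i ≤ 2 * η * (2 : ℝ) ^ L :=
      le_of_mul_le_mul_right (by nlinarith [mul_nonneg hX0 h2L.le]) hFpos
    -- the witness `p := Φ_i ∘ Γ`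
    set P := univ.filter fun u : Fin L → Bool => Φ i (Γ u) = true with hP_def
    have hPF : ((P ∩ F).card : ℝ) = F.card - X i := by
      have h1 : P ∩ F = F.filter fun u => Φ i (Γ u) = true := by
        rw [hP_def, Finset.filter_inter, Finset.univ_inter]
      have h2 : (F.filter fun u => Φ i (Γ u) = true).card +
          (F.filter fun u => Φ i (Γ u) = false).card = F.card := by
        have h := Finset.card_filter_add_card_filter_not
          (s := F) (fun u : Fin L → Bool => Φ i (Γ u) = true)
        simpa only [Bool.not_eq_true] using h
      have h3 : ((F.filter fun u => Φ i (Γ u) = true).card : ℝ) + X i = F.card := by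
        simp only [hX_def]; exact_mod_cast h2
      rw [h1]; linarith
    have hPN : ((P ∩ Nr).card : ℝ) = Y i := by
      have h1 : P ∩ Nr = Nr.filter fun u => Φ i (Γ u) = true := by
        rw [hP_def, Finset.filter_inter, Finset.univ_inter]
      rw [h1]
    have hPcard : (F.card : ℝ) / 2 ≤ (P.card : ℝ) := by
      have h1 : ((P ∩ F).card : ℝ) ≤ (P.card : ℝ) := by
        exact_mod_cast Finset.card_le_card Finset.inter_subset_left
      have h2 : 2 * η * (F.card : ℝ) ≤ (1 / 2) * F.card :=
        mul_le_mul_of_nonneg_right (by linarith) hFnn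
      linarith
    -- its degree
    have hdeg : HasDeg (fun u => Φ i (Γ u)) (⌊c' * Real.sqrt L⌋₊) := by
      have h1 : HasDeg (fun u => Φ i (Γ u)) ((A * s D + A) * D) :=
        compDeg L L' (A * s D + A) D (Φ i) Γ (hΦdeg i) hΓ
      refine hasDeg_of_le h1 (le_trans ?_ (hL₁ L hL₁L L' D hD))
      exact Nat.mul_le_mul_right _ (Nat.add_le_add_right (Nat.mul_le_mul_left _ (hB D)) _)
    refine ⟨fun u => Φ i (Γ u), hdeg, ?_, ?_⟩
    · -- capture: at least half of the far rows
      show 1 / 2 * (F.card : ℝ) - τ'' * (2 : ℝ) ^ L ≤ ((P ∩ F).card : ℝ)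
      rw [hPF]
      have h2 : 2 * η * (F.card : ℝ) ≤ (1 / 2) * F.card :=
        mul_le_mul_of_nonneg_right (by linarith) hFnn
      have h3 : (0 : ℝ) ≤ τ'' * (2 : ℝ) ^ L := by positivity
      linarith
    · -- leakage: the near rows inside `supp p` are few
      show ((P ∩ Nr ∩ cls L r).card : ℝ) ≤ b * (P.card : ℝ)
      have h1 : ((P ∩ Nr ∩ cls L r).card : ℝ) ≤ ((P ∩ Nr).card : ℝ) := by
        exact_mod_cast Finset.card_le_card Finset.inter_subset_left
      have h2 : b * ((F.card : ℝ) / 2) ≤ b * (P.card : ℝ) := mul_le_mul_of_nonneg_left hPcard hb.le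
      have h3 : 2 * η * (2 : ℝ) ^ L ≤ b * τ'' * (2 : ℝ) ^ L := mul_le_mul_of_nonneg_right hηb h2L.le
      nlinarith

/-! ### `CertParadigm` -/

/-- **`CertParadigm` — PROVED** (bookkeeping): `CertTransfer → RowCertPoly → RingHard 2`.  A polynomially
growing sufficient certificate family gives `FWSuff ⌊c'√·⌋` for EVERY `c' > 0` (`CertTransfer`), hence the
product bound by `productHard_of_fwSuff_sqrt_of_elimHard` and `elimHard`, hence hardness of the
cross-team game (`crossTeamHard_of_productHard`), of the walk game (`ringHardU_of_crossTeamHard`) and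
`RingHard 2` (`ringHard_two_of_walkHard`). -/
theorem certParadigm : CertParadigm := by
  intro hCT hRCP
  obtain ⟨s, hPG, hRC⟩ := hRCP
  have hW : ∃ c : ℝ, 0 < c ∧ ∀ c' : ℝ, 0 < c' → c' ≤ c → FWSuff (fun n => ⌊c' * Real.sqrt n⌋₊) :=
    ⟨1, one_pos, fun c' hc' _ => hCT s hPG hRC c' hc'⟩
  exact ringHard_two_of_walkHard (ringHardU_of_crossTeamHard
    (crossTeamHard_of_productHard (productHard_of_fwSuff_sqrt_of_elimHard hW elimHard)))

/-- α ⟸ `RowCertPoly`, unconditionally in `CertTransfer` (the paradigm's net statement in the kernel). -/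
theorem ringHard_two_of_rowCertPoly (h : RowCertPoly) : RingHard 2 := certParadigm certTransfer h

end Summit.QuantumAdvantage.AdviceFreeQNC0
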